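import Mathlib
import HarnessLib
import Literature.Probability.MarkovChains.PeskunOrdering

/-!
# The group inverse `(I − P)# = Z − 1π` of a finite Markov chain and Meyer's perturbation identity `π̃ − π = π̃ E (I − P)#`

HONEST FRAMING: exact (Metropolis-corrected) sampling algorithms for lattice gauge theory; figures
of merit are autocorrelation/cost numbers at stated couplings and volumes; no continuum-physics claim.

If a Markov chain with exact kernel `P` and stationary distribution `π` is actually RUN with a
perturbed kernel `P̃ = P + E` (an accept step evaluated with a finite solver residual, a
regulated operator, a noisy or approximated acceptance probability, floating point), what is the
stationary law `π̃` of the chain that was run?  This file formalises the algebraic core of the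
classical finite-state answer, as printed in Kirkland–Neumann, *Group Inverses of M-Matrices and
Their Applications* [cite: KirklandNeumann2012, §2.1, §5.1, §5.3, §6.1], in the row conventions of
`MetropolisHastings.lean` / `TotalVariation.lean` / `PeskunOrdering.lean` (`P x y` = probability of
`x → y`; laws are row vectors; `v ᵥ* P` is one step; `Z = fundamentalMatrix π P`,
`A = limitMatrix π = 1π`):

* the Kemeny–Snell identities `A² = A`, `PA = A`, `AP = A`, `AZ = ZA = A`,
  `(I − P)Z = Z(I − P) = I − A` (`one_sub_mul_fundamentalMatrix`, `fundamentalMatrix_mul_one_sub`)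
  [cite: KirklandNeumann2012, §6.1 (`Z = (I − T + 1wᵗ)⁻¹`, Kemeny–Snell [66, §4.3])];
* `groupInv π P = Z − A` — THE GROUP INVERSE `Q# = (I − P)#` in Meyer's closed form; `groupInv_eqns`:
  it satisfies the three defining equations `QXQ = Q`, `XQX = X`, `QX = XQ`
  [cite: KirklandNeumann2012, §2.1 eq. (2.1) (i)–(iii); §6.1 ("`(I − T)# = Z − 1wᵗ`")];
  `(I − P)Q# = Q#(I − P) = I − A`, `Q#1 = 0` (`sum_groupInv_row`), `πQ# = 0` (`vecMul_groupInv_self`);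
* `sub_eq_vecMul_vecMul_groupInv` — **MEYER'S PERTURBATION IDENTITY**
  `π̃ − π = π̃ E Q#`, `E = P̃ − P`, for ANY matrix `P̃` and any `π̃` with `Σ π̃ = 1`, `π̃P̃ = π̃`
  [cite: KirklandNeumann2012, §5.3 eq. (5.11)]; the same with `Z` in place of `Q#`
  (`sub_eq_vecMul_vecMul_fundamentalMatrix` — the fundamental-matrix form, which goes back to
  Schweitzer 1968); the fixed-point form `π = π̃ (I − EQ#)` (`eq_vecMul_one_sub_mul_groupInv`);
* `IsStationary.eq_of_isIrreducible`, `eq_smul_of_vecMul_eq` — corollary `E = 0`: the stationary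
  distribution of an irreducible row-stochastic matrix is UNIQUE, every left fixed vector is
  `(Σ v)·π` [cite: Norris1997, §1.7 Theorem 1.7.6, Exercise 1.7.5];
* `isUnit_one_sub_mul_groupInv`, `eq_vecMul_inv_one_sub_mul_groupInv` — **MEYER'S LEMMA**:
  for irreducible row-stochastic `P, P̃` the matrix `I − EQ#` is invertible and
  `π̃ = π (I − EQ#)⁻¹` [cite: KirklandNeumann2012, §5.3 Lemma 5.3.1 (Meyer [95] = Meyer 1980)]
  (our proof: a left null vector `v` of `I − EQ# = A + (I − P̃)Q#` has `Σv = 0`, then `vP̃ = v`,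
  then `v = 0` by uniqueness for `P̃` — instead of the book's orthogonal-similarity argument).

Everything is PROVED (0 named facts).  Sequels: `ErgodicityCoefficient.lean` (Seneta's `τ`,
Dobrushin contraction, Seneta's 1988 bound) and `StationaryPerturbation.lean` (the condition
numbers `τ(Q#)`, `κ(T)`, `‖Z‖_∞`, `‖Q#‖_∞` of KN Theorem 5.3.5 and the size of `E` for an
accept/reject chain with a perturbed acceptance probability).

Context (cell pub-lqcd, row 38 `r2-scope`, R2-SCOPE.md §3 E5 "accept-step solver residual",
E4 / X-5c "regulated operator in the accept step"): the bias of the chain actually run is EXACTLY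
`π̃ E Q#` — first order in the defect `E`, with the exact chain's group inverse as the coefficient.

## References

* S. J. Kirkland, M. Neumann, *Group Inverses of M-Matrices and Their Applications*, CRC Press
  2012, §2.1 eq. (2.1), §2.2 (vi), §5.1, §5.3 eq. (5.11) and Lemma 5.3.1, §6.1 [KirklandNeumann2012].
* C. D. Meyer, SIAM J. Algebraic Discrete Methods 1 (1980) 273–283 [Meyer1980] and P. J. Schweitzer,
  J. Appl. Probab. 5 (1968) 401–413 [Schweitzer1968] — originals, cited via the book (not read).
* P. H. Peskun, Biometrika 60 (1973) §2.1 (the fundamental matrix) [Peskun1973]; J. R. Norris,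
  *Markov Chains* (1997) §1.7 [Norris1997].
-/

namespace Literature.Probability.MarkovChains

open Finset Matrix

variable {X : Type*} [Fintype X] [DecidableEq X]

omit [DecidableEq X] in
/-- `(v M)_j = Σ_i v_i M_ij`. [folklore] -/
private theorem vecMul_apply' (v : X → ℝ) (M : Matrix X X ℝ) (j : X) :
    (v ᵥ* M) j = ∑ i, v i * M i j := rfl

omit [DecidableEq X] in
/-- Stationarity `πP = π` is the row-vector equation `π ᵥ* P = π`. [cite: KirklandNeumann2012, §5.1
(the stationary distribution vector: "`wᵗT = wᵗ` and `wᵗ1 = 1`")] -/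
theorem isStationary_iff_vecMul {π : X → ℝ} {P : Matrix X X ℝ} :
    IsStationary π P ↔ π ᵥ* P = π :=
  ⟨fun h => funext fun y => h y, fun h y => congrFun h y⟩

/-! ## The algebra of `A = 1π`, `Z` and `Q# = Z − A` -/

section Algebra

variable {π : X → ℝ} {P : Matrix X X ℝ}

omit [DecidableEq X] in
/-- `A² = A` for a probability vector `π`. [folklore] -/
private theorem limitMatrix_mul_limitMatrix (hπ1 : ∑ x, π x = 1) :
    limitMatrix π * limitMatrix π = limitMatrix π := by
  ext x y
  simp only [Matrix.mul_apply, limitMatrix, Matrix.of_apply]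
  rw [← sum_mul, hπ1, one_mul]

omit [DecidableEq X] in
/-- `PA = A` for any row-stochastic `P`. [folklore] -/
private theorem mul_limitMatrix_of_isRowStochastic (hP : IsRowStochastic P) :
    P * limitMatrix π = limitMatrix π := by
  ext x y
  simp only [Matrix.mul_apply, limitMatrix, Matrix.of_apply]
  rw [← sum_mul, hP.2 x, one_mul]

omit [DecidableEq X] in
/-- `AP = A` for a stationary `π`. [folklore] -/
private theorem limitMatrix_mul_of_isStationary (hst : IsStationary π P) :
    limitMatrix π * P = limitMatrix π := by
  ext x y
  simp only [Matrix.mul_apply, limitMatrix, Matrix.of_apply]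
  exact hst y

omit [DecidableEq X] in
/-- `v A = (Σ v) π`. [folklore] -/
private theorem vecMul_limitMatrix (v : X → ℝ) : v ᵥ* limitMatrix π = (∑ x, v x) • π := by
  funext y
  rw [vecMul_apply', Pi.smul_apply, smul_eq_mul, sum_mul]
  rfl

omit [DecidableEq X] in
/-- `A 1c = 1(cΣπ)`: `A` maps constants to constants; for a probability vector `A c = c`.
[folklore] -/
private theorem limitMatrix_mulVec_const (hπ1 : ∑ x, π x = 1) (c : ℝ) :
    limitMatrix π *ᵥ (fun _ => c) = fun _ => c := by
  funext x
  simp only [mulVec, dotProduct, limitMatrix, Matrix.of_apply]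
  rw [← sum_mul, hπ1, one_mul]

/-- `A Z = A` (from `A(I − P + A) = A − A + A`). [folklore] -/
private theorem limitMatrix_mul_fundamentalMatrix (hπ1 : ∑ x, π x = 1) (hst : IsStationary π P)
    (hK : IsUnit (1 - (P - limitMatrix π))) :
    limitMatrix π * fundamentalMatrix π P = limitMatrix π := by
  have h1 : limitMatrix π * (1 - (P - limitMatrix π)) = limitMatrix π := by
    rw [Matrix.mul_sub, Matrix.mul_sub, Matrix.mul_one, limitMatrix_mul_of_isStationary hst,
      limitMatrix_mul_limitMatrix hπ1, sub_self, sub_zero]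
  calc limitMatrix π * fundamentalMatrix π P
      = limitMatrix π * (1 - (P - limitMatrix π)) * fundamentalMatrix π P := by rw [h1]
    _ = limitMatrix π := by
        rw [Matrix.mul_assoc, fundamentalInv_mul_fundamentalMatrix hK, Matrix.mul_one]

/-- `Z A = A` (from `(I − P + A)A = A − A + A`). [folklore] -/
private theorem fundamentalMatrix_mul_limitMatrix (hP : IsRowStochastic P) (hπ1 : ∑ x, π x = 1)
    (hK : IsUnit (1 - (P - limitMatrix π))) :
    fundamentalMatrix π P * limitMatrix π = limitMatrix π := by
  have h1 : (1 - (P - limitMatrix π)) * limitMatrix π = limitMatrix π := by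
    rw [Matrix.sub_mul, Matrix.sub_mul, Matrix.one_mul, mul_limitMatrix_of_isRowStochastic hP,
      limitMatrix_mul_limitMatrix hπ1, sub_self, sub_zero]
  calc fundamentalMatrix π P * limitMatrix π
      = fundamentalMatrix π P * ((1 - (P - limitMatrix π)) * limitMatrix π) := by rw [h1]
    _ = limitMatrix π := by
        rw [← Matrix.mul_assoc, fundamentalMatrix_mul_fundamentalInv hK, Matrix.one_mul]

/-- KEMENY–SNELL: `(I − P) Z = I − A`. [cite: KirklandNeumann2012, §6.1 (the fundamental matrix
`Z = (I − T + 1wᵗ)⁻¹` of Kemeny–Snell [66, §4.3])]; [cite: Peskun1973, §2.1 Definition 2.1.1] -/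
theorem one_sub_mul_fundamentalMatrix (hπ1 : ∑ x, π x = 1) (hst : IsStationary π P)
    (hK : IsUnit (1 - (P - limitMatrix π))) :
    (1 - P) * fundamentalMatrix π P = 1 - limitMatrix π := by
  have h1 : (1 : Matrix X X ℝ) - P = (1 - (P - limitMatrix π)) - limitMatrix π := by abel
  rw [h1, Matrix.sub_mul, fundamentalInv_mul_fundamentalMatrix hK,
    limitMatrix_mul_fundamentalMatrix hπ1 hst hK]

/-- KEMENY–SNELL: `Z (I − P) = I − A`. [cite: KirklandNeumann2012, §6.1]; [cite: Peskun1973, §2.1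
Definition 2.1.1] -/
theorem fundamentalMatrix_mul_one_sub (hP : IsRowStochastic P) (hπ1 : ∑ x, π x = 1)
    (hK : IsUnit (1 - (P - limitMatrix π))) :
    fundamentalMatrix π P * (1 - P) = 1 - limitMatrix π := by
  have h1 : (1 : Matrix X X ℝ) - P = (1 - (P - limitMatrix π)) - limitMatrix π := by abel
  rw [h1, Matrix.mul_sub, fundamentalMatrix_mul_fundamentalInv hK,
    fundamentalMatrix_mul_limitMatrix hP hπ1 hK]

/-- The GROUP INVERSE `Q# = (I − P)#` of `Q = I − P`, in Meyer's closed form `Q# = Z − 1π`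
(fundamental matrix minus limiting matrix). [cite: KirklandNeumann2012, §6.1 ("`(I − T)# = Z − 1wᵗ`,
a fact readily verified"), §2.1 eq. (2.1)] -/
noncomputable def groupInv (π : X → ℝ) (P : Matrix X X ℝ) : Matrix X X ℝ :=
  fundamentalMatrix π P - limitMatrix π

/-- `(I − P) Q# = I − 1π`. [cite: KirklandNeumann2012, §2.2 (vi) ("`BB# = B#B = I − xyᵗ`" for a
simple eigenvalue `0`), §5.3 proof of Lemma 5.3.1 (`QQ# = I − 1wᵗ`)] -/
theorem one_sub_mul_groupInv (hP : IsRowStochastic P) (hπ1 : ∑ x, π x = 1)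
    (hst : IsStationary π P) (hK : IsUnit (1 - (P - limitMatrix π))) :
    (1 - P) * groupInv π P = 1 - limitMatrix π := by
  rw [groupInv, Matrix.mul_sub, one_sub_mul_fundamentalMatrix hπ1 hst hK, Matrix.sub_mul,
    Matrix.one_mul, mul_limitMatrix_of_isRowStochastic hP, sub_self, sub_zero]

/-- `Q# (I − P) = I − 1π`. [cite: KirklandNeumann2012, §2.2 (vi), §6.1 ("since `Q#Q = I − 1wᵗ`")] -/
theorem groupInv_mul_one_sub (hP : IsRowStochastic P) (hπ1 : ∑ x, π x = 1)
    (hst : IsStationary π P) (hK : IsUnit (1 - (P - limitMatrix π))) :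
    groupInv π P * (1 - P) = 1 - limitMatrix π := by
  rw [groupInv, Matrix.sub_mul, fundamentalMatrix_mul_one_sub hP hπ1 hK, Matrix.mul_sub,
    Matrix.mul_one, limitMatrix_mul_of_isStationary hst, sub_self, sub_zero]

/-- **`Z − 1π` IS THE GROUP INVERSE OF `Q = I − P`**: it satisfies the three defining equations
`QXQ = Q`, `XQX = X`, `QX = XQ`. [cite: KirklandNeumann2012, §2.1 eq. (2.1) (i)–(iii), §6.1
("`(I − T)# = Z − 1wᵗ`")] -/
theorem groupInv_eqns (hP : IsRowStochastic P) (hπ1 : ∑ x, π x = 1) (hst : IsStationary π P)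
    (hK : IsUnit (1 - (P - limitMatrix π))) :
    (1 - P) * groupInv π P * (1 - P) = 1 - P ∧
      groupInv π P * (1 - P) * groupInv π P = groupInv π P ∧
      (1 - P) * groupInv π P = groupInv π P * (1 - P) := by
  refine ⟨?_, ?_, ?_⟩
  · rw [one_sub_mul_groupInv hP hπ1 hst hK, Matrix.sub_mul, Matrix.one_mul, Matrix.mul_sub,
      Matrix.mul_one, limitMatrix_mul_of_isStationary hst, sub_self, sub_zero]
  · rw [groupInv_mul_one_sub hP hπ1 hst hK, Matrix.sub_mul, Matrix.one_mul, groupInv,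
      Matrix.mul_sub, limitMatrix_mul_fundamentalMatrix hπ1 hst hK,
      limitMatrix_mul_limitMatrix hπ1, sub_self, sub_zero]
  · rw [one_sub_mul_groupInv hP hπ1 hst hK, groupInv_mul_one_sub hP hπ1 hst hK]

/-- `Q# 1 = 0` (`Z1 = 1`, `A1 = 1`): the rows of the group inverse sum to zero.
[cite: KirklandNeumann2012, §5.3 proof of Corollary 5.3.9 ("`Σ_k q#_{i,k} = 0`")] -/
theorem groupInv_mulVec_const (hP : IsRowStochastic P) (hπ1 : ∑ x, π x = 1)
    (hK : IsUnit (1 - (P - limitMatrix π))) (c : ℝ) :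
    groupInv π P *ᵥ (fun _ => c) = 0 := by
  rw [groupInv, sub_mulVec, fundamentalMatrix_mulVec_const hP hπ1 hK, limitMatrix_mulVec_const hπ1,
    sub_self]

/-- Row sums of `Q#` vanish: `Σ_k Q#_{ik} = 0`. [cite: KirklandNeumann2012, §5.3 proof of
Corollary 5.3.9] -/
theorem sum_groupInv_row (hP : IsRowStochastic P) (hπ1 : ∑ x, π x = 1)
    (hK : IsUnit (1 - (P - limitMatrix π))) (i : X) :
    ∑ k, groupInv π P i k = 0 := by
  have h := congrFun (groupInv_mulVec_const hP hπ1 hK 1) i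
  simpa [mulVec, dotProduct] using h

/-- `π Z = π`. [folklore] -/
private theorem vecMul_fundamentalMatrix' (hπ1 : ∑ x, π x = 1) (hst : IsStationary π P)
    (hK : IsUnit (1 - (P - limitMatrix π))) : π ᵥ* fundamentalMatrix π P = π := by
  have h1 : π ᵥ* (1 - (P - limitMatrix π)) = π := by
    rw [vecMul_sub, vecMul_sub, vecMul_one, isStationary_iff_vecMul.1 hst, vecMul_limitMatrix, hπ1,
      one_smul, sub_self, sub_zero]
  calc π ᵥ* fundamentalMatrix π P
      = π ᵥ* (1 - (P - limitMatrix π)) ᵥ* fundamentalMatrix π P := by rw [h1]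
    _ = π := by rw [vecMul_vecMul, fundamentalInv_mul_fundamentalMatrix hK, vecMul_one]

/-- `π Q# = 0`. [cite: KirklandNeumann2012, §6.1 Remark 6.1.2 ("using the facts that `wᵗQ# = 0ᵗ`
and `wᵗ1 = 1`")] -/
theorem vecMul_groupInv_self (hπ1 : ∑ x, π x = 1) (hst : IsStationary π P)
    (hK : IsUnit (1 - (P - limitMatrix π))) : π ᵥ* groupInv π P = 0 := by
  rw [groupInv, vecMul_sub, vecMul_fundamentalMatrix' hπ1 hst hK, vecMul_limitMatrix, hπ1, one_smul,
    sub_self]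

end Algebra

/-! ## The perturbation identity and its first consequences -/

section Identity

variable {π π' : X → ℝ} {P P' : Matrix X X ℝ}

omit [DecidableEq X] in
/-- `Σ_y (uM)_y = Σ_x u_x (Σ_y M_xy)`. [folklore] -/
private theorem sum_vecMul (u : X → ℝ) (M : Matrix X X ℝ) :
    ∑ y, (u ᵥ* M) y = ∑ x, u x * ∑ y, M x y := by
  simp_rw [vecMul_apply', mul_sum]
  exact sum_comm

omit [DecidableEq X] in
/-- A row-stochastic matrix preserves the total mass of a row vector. [folklore] -/
private theorem sum_vecMul_of_isRowStochastic (hP : IsRowStochastic P) (u : X → ℝ) :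
    ∑ y, (u ᵥ* P) y = ∑ x, u x := by
  rw [sum_vecMul]
  exact sum_congr rfl fun x _ => by rw [hP.2 x, mul_one]

/-- **THE PERTURBATION IDENTITY** (Meyer): if `π` is the stationary probability vector of the
irreducible row-stochastic `P` (so that `Q# = (I − P)#` exists) and `π̃` is ANY vector with
`Σ π̃ = 1` that is stationary for ANOTHER matrix `P̃` (no hypothesis on `P̃`), then with
`E = P̃ − P`:  `π̃ − π = π̃ E Q#`. [cite: KirklandNeumann2012, §5.3 eq. (5.11)
("`w̃ᵗ − wᵗ = w̃ᵗ(I − 1wᵗ) = w̃ᵗQQ# = w̃ᵗEQ#`") and Lemma 5.3.1 (Meyer [95])] -/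
theorem sub_eq_vecMul_vecMul_groupInv (hP : IsRowStochastic P) (hπ1 : ∑ x, π x = 1)
    (hst : IsStationary π P) (hK : IsUnit (1 - (P - limitMatrix π)))
    (hπ'1 : ∑ x, π' x = 1) (hst' : IsStationary π' P') :
    π' - π = π' ᵥ* (P' - P) ᵥ* groupInv π P := by
  have h1 : π' ᵥ* (P' - P) = π' ᵥ* (1 - P) := by
    rw [vecMul_sub, vecMul_sub, vecMul_one, isStationary_iff_vecMul.1 hst']
  rw [h1, vecMul_vecMul, one_sub_mul_groupInv hP hπ1 hst hK, vecMul_sub, vecMul_one,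
    vecMul_limitMatrix, hπ'1, one_smul]

/-- The same identity with the FUNDAMENTAL MATRIX (Schweitzer's form): `π̃ − π = π̃ E Z`
(`π̃E` has zero sum, and zero-sum vectors do not see `A = Z − Q#`).
[cite: KirklandNeumann2012, §5.3 eq. (5.11) with §6.1 (`(I − T)# = Z − 1wᵗ`)];
[cite: Schweitzer1968, (the original fundamental-matrix perturbation formula — attribution per
KirklandNeumann2012 §5.3 / Cho–Meyer [23]; original not read)] -/
theorem sub_eq_vecMul_vecMul_fundamentalMatrix (hπ1 : ∑ x, π x = 1)
    (hst : IsStationary π P) (hK : IsUnit (1 - (P - limitMatrix π)))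
    (hπ'1 : ∑ x, π' x = 1) (hst' : IsStationary π' P') :
    π' - π = π' ᵥ* (P' - P) ᵥ* fundamentalMatrix π P := by
  have h1 : π' ᵥ* (P' - P) = π' ᵥ* (1 - P) := by
    rw [vecMul_sub, vecMul_sub, vecMul_one, isStationary_iff_vecMul.1 hst']
  rw [h1, vecMul_vecMul, one_sub_mul_fundamentalMatrix hπ1 hst hK, vecMul_sub, vecMul_one,
    vecMul_limitMatrix, hπ'1, one_smul]

/-- Fixed-point form of the identity: `π = π̃ (I − E Q#)`. [cite: KirklandNeumann2012, §5.3
Lemma 5.3.1, proof ("Hence we have `wᵗ = w̃ᵗ(I − EQ#)`")] -/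
theorem eq_vecMul_one_sub_mul_groupInv (hP : IsRowStochastic P) (hπ1 : ∑ x, π x = 1)
    (hst : IsStationary π P) (hK : IsUnit (1 - (P - limitMatrix π)))
    (hπ'1 : ∑ x, π' x = 1) (hst' : IsStationary π' P') :
    π = π' ᵥ* (1 - (P' - P) * groupInv π P) := by
  rw [vecMul_sub, vecMul_one, ← vecMul_vecMul,
    ← sub_eq_vecMul_vecMul_groupInv hP hπ1 hst hK hπ'1 hst', sub_sub_cancel]

/-- **UNIQUENESS OF THE STATIONARY DISTRIBUTION** of an irreducible row-stochastic matrix (the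
identity with `P̃ = P`, `E = 0`): any `π̃` with `Σ π̃ = 1` and `π̃P = π̃` equals `π`.
[cite: KirklandNeumann2012, §5.1 ("We still have a unique stationary distribution vector `w > 0`
with `wᵗT = wᵗ` and `wᵗ1 = 1`" for `T` irreducible)]; [cite: Norris1997, §1.7 Theorem 1.7.6
(invariant measures of an irreducible recurrent chain are unique up to scalar multiples) and
Exercise 1.7.5 (finite irreducible `P`: `I − P + A` invertible)] -/
theorem IsStationary.eq_of_isIrreducible (hP : IsRowStochastic P) (hπ1 : ∑ x, π x = 1)
    (hst : IsStationary π P) (hirr : IsIrreducible P) (hπ'1 : ∑ x, π' x = 1)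
    (hst' : IsStationary π' P) : π' = π := by
  have h := sub_eq_vecMul_vecMul_groupInv hP hπ1 hst (isUnit_fundamentalInv hπ1 hP hst hirr) hπ'1 hst'
  rw [sub_self, vecMul_zero, zero_vecMul] at h
  exact sub_eq_zero.1 h

/-- Signed version: every left fixed vector `vP = v` of an irreducible row-stochastic `P` is the
multiple `(Σ v)·π` of the stationary distribution (the left null space of `I − P` is the line
`ℝπ`). [cite: KirklandNeumann2012, §5.1 (stationary vector of `T ∈ IS_n`; `1` is an algebraically
simple eigenvalue)] -/
theorem eq_smul_of_vecMul_eq (hP : IsRowStochastic P) (hπ1 : ∑ x, π x = 1)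
    (hst : IsStationary π P) (hK : IsUnit (1 - (P - limitMatrix π))) {v : X → ℝ}
    (hv : v ᵥ* P = v) : v = (∑ x, v x) • π := by
  have h1 : v ᵥ* (1 - P) = 0 := by rw [vecMul_sub, vecMul_one, hv, sub_self]
  have h2 : v ᵥ* (1 - P) ᵥ* groupInv π P = v - (∑ x, v x) • π := by
    rw [vecMul_vecMul, one_sub_mul_groupInv hP hπ1 hst hK, vecMul_sub, vecMul_one, vecMul_limitMatrix]
  rw [h1, zero_vecMul] at h2
  exact (sub_eq_zero.1 h2.symm)

/-- **MEYER'S LEMMA**: for irreducible row-stochastic `P, P̃` with stationary distributions `π, π̃`,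
the matrix `I − EQ#` (`E = P̃ − P`, `Q# = (I − P)#`) is invertible.
[cite: KirklandNeumann2012, §5.3 Lemma 5.3.1 (Meyer [95] = Meyer 1980)] -/
theorem isUnit_one_sub_mul_groupInv (hP : IsRowStochastic P) (hπ1 : ∑ x, π x = 1)
    (hst : IsStationary π P) (hK : IsUnit (1 - (P - limitMatrix π)))
    (hP' : IsRowStochastic P') (hπ'1 : ∑ x, π' x = 1) (hst' : IsStationary π' P')
    (hK' : IsUnit (1 - (P' - limitMatrix π'))) :
    IsUnit (1 - (P' - P) * groupInv π P) := by
  rw [← vecMul_injective_iff_isUnit]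
  intro v w hvw
  set d := v - w with hd
  -- `I − EQ# = A + (I − P̃)Q#`
  have hM : (1 : Matrix X X ℝ) - (P' - P) * groupInv π P
      = limitMatrix π + (1 - P') * groupInv π P := by
    have h3 : (P' - P) * groupInv π P = (1 - P) * groupInv π P - (1 - P') * groupInv π P := by
      rw [← Matrix.sub_mul]; congr 1; abel
    rw [h3, one_sub_mul_groupInv hP hπ1 hst hK]; abel
  have h0 : d ᵥ* (limitMatrix π + (1 - P') * groupInv π P) = 0 := by
    rw [← hM, hd, sub_vecMul]
    exact sub_eq_zero.2 hvw
  rw [vecMul_add, vecMul_limitMatrix, ← vecMul_vecMul] at h0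
  set u := d ᵥ* (1 - P') with hu
  -- total mass of `d` vanishes: sum the coordinates (`Q#1 = 0`, `Σπ = 1`)
  have hsum_u : ∑ y, (u ᵥ* groupInv π P) y = 0 := by
    rw [sum_vecMul]
    exact sum_eq_zero fun x _ => by rw [sum_groupInv_row hP hπ1 hK, mul_zero]
  have hd0 : ∑ x, d x = 0 := by
    have h4 := congrArg (fun f : X → ℝ => ∑ y, f y) h0
    simp only [Pi.add_apply, Pi.smul_apply, smul_eq_mul, sum_add_distrib, Pi.zero_apply,
      sum_const_zero] at h4
    rw [← mul_sum, hπ1, mul_one, hsum_u, add_zero] at h4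
    exact h4
  rw [hd0, zero_smul, zero_add] at h0
  -- `u` has zero sum, and `u Q# (I − P) = u − (Σu)π = u`, so `u = 0`, i.e. `d P̃ = d`
  have hu0 : ∑ x, u x = 0 := by
    rw [hu, vecMul_sub, vecMul_one]
    simp only [Pi.sub_apply, sum_sub_distrib]
    rw [sum_vecMul_of_isRowStochastic hP', hd0, sub_self]
  have hu_zero : u = 0 := by
    have h5 : u ᵥ* groupInv π P ᵥ* (1 - P) = 0 := by rw [h0, zero_vecMul]
    rw [vecMul_vecMul, groupInv_mul_one_sub hP hπ1 hst hK, vecMul_sub, vecMul_one,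
      vecMul_limitMatrix, hu0, zero_smul, sub_zero] at h5
    exact h5
  have hdP : d ᵥ* P' = d := by
    rw [hu, vecMul_sub, vecMul_one] at hu_zero
    exact (sub_eq_zero.1 hu_zero).symm
  -- uniqueness for `P̃`
  have h6 := eq_smul_of_vecMul_eq hP' hπ'1 hst' hK' hdP
  rw [hd0, zero_smul] at h6
  exact sub_eq_zero.1 h6

/-- **MEYER'S FORMULA** `π̃ = π (I − EQ#)⁻¹`. [cite: KirklandNeumann2012, §5.3 Lemma 5.3.1
("`w̃ᵗ = wᵗ(I − EQ#)⁻¹`")] -/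
theorem eq_vecMul_inv_one_sub_mul_groupInv (hP : IsRowStochastic P) (hπ1 : ∑ x, π x = 1)
    (hst : IsStationary π P) (hK : IsUnit (1 - (P - limitMatrix π)))
    (hP' : IsRowStochastic P') (hπ'1 : ∑ x, π' x = 1) (hst' : IsStationary π' P')
    (hK' : IsUnit (1 - (P' - limitMatrix π'))) :
    π' = π ᵥ* (1 - (P' - P) * groupInv π P)⁻¹ := by
  have hM := isUnit_one_sub_mul_groupInv hP hπ1 hst hK hP' hπ'1 hst' hK'
  have h := eq_vecMul_one_sub_mul_groupInv hP hπ1 hst hK hπ'1 hst' (P' := P')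
  calc π' = π' ᵥ* ((1 - (P' - P) * groupInv π P) * (1 - (P' - P) * groupInv π P)⁻¹) := by
        rw [mul_nonsing_inv _ ((isUnit_iff_isUnit_det _).1 hM), vecMul_one]
    _ = π ᵥ* (1 - (P' - P) * groupInv π P)⁻¹ := by rw [← vecMul_vecMul, ← h]

end Identity

end Literature.Probability.MarkovChains
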